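import Summits.AtomisticToContinuum.HydrodynamicLimit.Theorems.OneFlightGossipEngineEquilibriumClampedCollisionalWindowLDStubMeasurability
import Summits.AtomisticToContinuum.HydrodynamicLimit.Theorems.OneFlightGossipEngineEnergyCurrentTailsLevelCensusPreCollisionFlux
import Literature.MathematicalPhysics.KineticTheory.HardSphereTwoTimePressure

/-!
# Stationary truncation of the transfer activity
(crux `TwoClocks.ClampedTransferWindowLD` = C′, stmt-AtomisticToContinuum-16623; line `Sketch`, rung R1
`stub_stationaryTruncation`, registered signature verbatim in
`Summit.AtomisticToContinuum.HydrodynamicLimit.Theorems.ClampedTransferCoin.SketchLine`)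

Support file (`--supports stmt-AtomisticToContinuum-16623`) in the vocabulary of
`Theorems/OneFlightGossipEngineEquilibriumClampedCollisionalWindowLDDefs` (`Flow`, `Phase`, `Rec`, `gibbs`, `window`,
`impulse`, `runAct`). Card `Cruxes/ClampedTransferWindowLD/Ideas/stationary-truncation-clamp-deficit.md`, **Lever** and
**First lemma**: along integer multiples of a base window the transfer activity of particle `i` is an AVERAGE of
shifted copies of itself, so Jensen for `x ↦ (x − M)₊` and the flow-invariance of the homogeneous Gibbs law bound the
`M`-excess over the long window by the one-window excess, for every `K ≥ 1`, `M`, `N`.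

* `collisionSum_Ioc_add_Ioc` — additivity of collision sums along the flow over adjacent windows `(a, b] ∪ (b, c]` on
  the good set (`collisionPairSum_union`, finitely many collision times in bounded windows).
* `collisionSum_Ioc_natMul_eq_sum` — **window concatenation**: for a functional of the record that does not read the
  time stamp, the collision sum over `(0, K w]` along the orbit of a good `z` is the sum over `k < K` of the collision
  sums over `(0, w]` along the orbits of `Φ_{k w} z` (induction on `K`; each piece is the shifted one-window sum by
  `EnergyCurrentTailsLevelCensus.collisionSum_Ioc_eq_collisionSum_flow`).
* `runAct_natMul_eq_avg` — `act_i^{(K τ₁)}(z) = K⁻¹ Σ_{k<K} act_i^{(τ₁)}(Φ_{k w₁} z)` on the good set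
  (`w₁ = window τ₁ N`; `window (K τ₁) N = K w₁` and `σ/(K τ₁) = K⁻¹ · σ/τ₁`).
* `ofReal_finset_sum_le`, `ofReal_avg_sub_le` — subadditivity of `ENNReal.ofReal` over finite sums and the resulting
  convexity inequality `ofReal (K⁻¹ Σ_k b_k − M) ≤ ofReal K⁻¹ · Σ_k ofReal (b_k − M)`.
* `SketchLine.stub_stationaryTruncation` — the registered stub: integrate the pointwise inequality (good set is
  `G_N`-a.e., `ae_mem_good_localGibbsLaw`), exchange sum and integral (measurability from
  `measurable_indicator_runAct_window`, `0 < σ < 1/2`), and use `∫⁻ G ∘ Φ_t dG_N = ∫⁻ G dG_N`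
  (`lintegral_comp_flow_localGibbsLaw_const`) for each of the `K` shifted copies.

No new definitions. prover-line-stmt-AtomisticToContinuum-16623-0, 2026-08-16.
-/

noncomputable section

open MeasureTheory ProbabilityTheory Set Filter
open scoped ENNReal BigOperators
open Literature.Analysis.FluidPDE Literature.MathematicalPhysics.KineticTheory

namespace Summit.AtomisticToContinuum.HydrodynamicLimit.Theorems.ClampedTransferCoin

variable {σ : ℝ} {N : ℕ}

/-! ## Window algebra on the good set -/

/-- **Additivity of collision sums along the flow over adjacent windows** `(a, c] = (a, b] ∪ (b, c]` on the good set
(finitely many collision times in bounded windows). -/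
theorem collisionSum_Ioc_add_Ioc {M : Type*} [AddCommMonoid M] (Φ : Flow σ N) {z : Phase N} (hz : z ∈ Φ.good)
    {a b c : ℝ} (hab : a ≤ b) (hbc : b ≤ c) (g : Rec N → M) :
    Φ.collisionSum (Ioc a c) g z = Φ.collisionSum (Ioc a b) g z + Φ.collisionSum (Ioc b c) g z := by
  rw [HardSphereFlow.collisionSum_eq, HardSphereFlow.collisionSum_eq, HardSphereFlow.collisionSum_eq,
    collisionSum_eq_collisionPairSum, collisionSum_eq_collisionPairSum, collisionSum_eq_collisionPairSum,
    ← Ioc_union_Ioc_eq_Ioc hab hbc,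
    collisionPairSum_union (Φ.finite_collisionTimes_inter hz Ioc_subset_Icc_self)
      (Φ.finite_collisionTimes_inter hz Ioc_subset_Icc_self) (Ioc_disjoint_Ioc_of_le le_rfl)]

/-- **Window concatenation.** For a functional `g` of the record that does not read the time stamp, on a good orbit
the collision sum over `(0, K w]` (`w ≥ 0`, `K : ℕ`) is the sum over `k < K` of the collision sums over `(0, w]` along
the orbits of the shifted data `Φ_{k w} z`. -/
theorem collisionSum_Ioc_natMul_eq_sum {M : Type*} [AddCommMonoid M] (Φ : Flow σ N) {z : Phase N}
    (hz : z ∈ Φ.good) {w : ℝ} (hw : 0 ≤ w) (g : Rec N → M)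
    (hg : ∀ (y : Phase N) (t t' : ℝ) (k l : Fin (N + 1)),
      g (HardSphereCollisionRecord.ofConfig (Torus.geometry (Fin 3)) (hsDiameter σ N) y t k l) =
        g (HardSphereCollisionRecord.ofConfig (Torus.geometry (Fin 3)) (hsDiameter σ N) y t' k l))
    (K : ℕ) :
    Φ.collisionSum (Ioc 0 ((K : ℝ) * w)) g z =
      ∑ k ∈ Finset.range K, Φ.collisionSum (Ioc 0 w) g (Φ.flow ((k : ℝ) * w) z) := by
  induction K with
  | zero =>
    rw [Finset.sum_range_zero, Nat.cast_zero, zero_mul, Ioc_self, HardSphereFlow.collisionSum_eq,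
      collisionSum_eq_collisionPairSum, collisionPairSum_empty]
  | succ K ih =>
    have h1 : (0 : ℝ) ≤ (K : ℝ) * w := mul_nonneg K.cast_nonneg hw
    have h2 : (K : ℝ) * w ≤ ((K : ℝ) + 1) * w := by nlinarith
    have h3 : ((K : ℝ) + 1) * w - (K : ℝ) * w = w := by ring
    rw [Finset.sum_range_succ, ← ih, Nat.cast_succ, collisionSum_Ioc_add_Ioc Φ hz h1 h2 g,
      EnergyCurrentTailsLevelCensus.collisionSum_Ioc_eq_collisionSum_flow Φ hz ((K : ℝ) * w)
        (((K : ℝ) + 1) * w) g hg, h3]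

/-- **The transfer activity over `K` windows is the average of the `K` shifted one-window activities** (good set):
`act_i^{(K τ₁)}(z) = K⁻¹ Σ_{k<K} act_i^{(τ₁)}(Φ_{k w₁} z)`, `w₁ = window τ₁ N` (both sides vanish for `K = 0`). -/
theorem runAct_natMul_eq_avg (Φ : Flow σ N) {z : Phase N} (hz : z ∈ Φ.good) {τ₁ : ℝ} (hτ₁ : 0 < τ₁)
    (i : Fin (N + 1)) (K : ℕ) :
    runAct σ (K * τ₁) Φ (window (K * τ₁) N) i z =
      (K : ℝ)⁻¹ * ∑ k ∈ Finset.range K, runAct σ τ₁ Φ (window τ₁ N) i (Φ.flow ((k : ℝ) * window τ₁ N) z) := by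
  have hsplit := collisionSum_Ioc_natMul_eq_sum Φ hz (window_pos hτ₁ N).le
    (fun c : Rec N => if c.fst = i then impulse c else 0) (fun _ _ _ _ _ => rfl) K
  -- the kinetic window is linear in `τ` (landed as `CollisionActivityTailsWindowAlgebra.window_mul` for that line's copy
  -- of `window`; one `ring` here rather than an import of the `CollisionActivityTails` files)
  have hwin : window ((K : ℝ) * τ₁) N = (K : ℝ) * window τ₁ N := by
    unfold window
    ring
  unfold runAct
  rw [hwin, hsplit, Finset.mul_sum, Finset.mul_sum]
  exact Finset.sum_congr rfl fun k _ => by ring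

/-! ## Jensen for the positive part of a finite average, `ℝ≥0∞` form -/

/-- `ENNReal.ofReal` of a finite sum is at most the sum of the `ENNReal.ofReal`s (subadditivity of the positive
part). -/
theorem ofReal_finset_sum_le {ι : Type*} (s : Finset ι) (f : ι → ℝ) :
    ENNReal.ofReal (∑ k ∈ s, f k) ≤ ∑ k ∈ s, ENNReal.ofReal (f k) :=
  Finset.le_sum_of_subadditive ENNReal.ofReal ENNReal.ofReal_zero.le (fun _ _ => ENNReal.ofReal_add_le) s f

/-- **Convexity of `x ↦ (x − M)₊` along a finite average**, `ℝ≥0∞` form: for `K ≠ 0`,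
`ofReal (K⁻¹ Σ_{k<K} b_k − M) ≤ ofReal K⁻¹ · Σ_{k<K} ofReal (b_k − M)`. -/
theorem ofReal_avg_sub_le {K : ℕ} (hK : K ≠ 0) (b : ℕ → ℝ) (M : ℝ) :
    ENNReal.ofReal ((K : ℝ)⁻¹ * ∑ k ∈ Finset.range K, b k - M) ≤
      ENNReal.ofReal ((K : ℝ)⁻¹) * ∑ k ∈ Finset.range K, ENNReal.ofReal (b k - M) := by
  have hK0 : (K : ℝ) ≠ 0 := Nat.cast_ne_zero.2 hK
  have h : (K : ℝ)⁻¹ * ∑ k ∈ Finset.range K, b k - M = (K : ℝ)⁻¹ * ∑ k ∈ Finset.range K, (b k - M) := by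
    rw [Finset.sum_sub_distrib, Finset.sum_const, Finset.card_range, nsmul_eq_mul, mul_sub,
      inv_mul_cancel_left₀ hK0]
  rw [h, ENNReal.ofReal_mul (inv_nonneg.2 (Nat.cast_nonneg K))]
  exact mul_le_mul_right (ofReal_finset_sum_le _ _) _

/-! ## The registered stub -/

namespace SketchLine

/-- **R1 · STATIONARY TRUNCATION** (registered stub of line `Sketch`; card stationary-truncation-clamp-deficit,
`StationaryTruncation`). Under the homogeneous Gibbs law `G_N`, for `0 < σ < 1/2`, `0 < τ₁` and every `K ≥ 1`, `M`,
`N`, particle `i`: `∫⁻ ofReal (act_i^{(K τ₁)} − M) dG_N ≤ ∫⁻ ofReal (act_i^{(τ₁)} − M) dG_N`, where `act_i^{(τ)} =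
runAct σ τ Φ (window τ N) i` is the window transfer activity of C′. Proof: on the good set (a.e.)
`act^{(K τ₁)} = K⁻¹ Σ_{k<K} act^{(τ₁)} ∘ Φ_{k w₁}` (`runAct_natMul_eq_avg`), Jensen for `(· − M)₊`
(`ofReal_avg_sub_le`), and each shifted copy has the same `G_N`-integral (`lintegral_comp_flow_localGibbsLaw_const`). -/
theorem stub_stationaryTruncation :
    ∀ (σ a₀ θ₀ : ℝ) (u₀ : V3) (τ₁ M : ℝ) (N : ℕ) (Φ : Flow σ N) (i : Fin (N + 1)) (K : ℕ),
      0 < σ → σ < 1 / 2 → 0 < τ₁ → 1 ≤ K →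
        ∫⁻ z, ENNReal.ofReal (runAct σ (K * τ₁) Φ (window (K * τ₁) N) i z - M) ∂(gibbs σ a₀ θ₀ u₀ N Φ) ≤
          ∫⁻ z, ENNReal.ofReal (runAct σ τ₁ Φ (window τ₁ N) i z - M) ∂(gibbs σ a₀ θ₀ u₀ N Φ) := by
  intro σ a₀ θ₀ u₀ τ₁ M N Φ i K hσ hσ2 hτ₁ hK
  have hK0 : K ≠ 0 := Nat.one_le_iff_ne_zero.1 hK
  have hKr : (K : ℝ) ≠ 0 := Nat.cast_ne_zero.2 hK0
  have hae : ∀ᵐ z ∂(gibbs σ a₀ θ₀ u₀ N Φ), z ∈ Φ.good :=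
    ae_mem_good_localGibbsLaw σ (fun _ => a₀) (fun _ => u₀) (fun _ => θ₀) N Φ
  -- the one-window excess functional, read through the good-set indicator (measurable in the datum)
  obtain ⟨G, hG⟩ : ∃ G : Phase N → ℝ≥0∞,
      G = fun z => ENNReal.ofReal (Φ.good.indicator (runAct σ τ₁ Φ (window τ₁ N) i) z - M) := ⟨_, rfl⟩
  have hGm : Measurable G := by
    rw [hG]
    exact ((measurable_indicator_runAct_window hσ hσ2 τ₁ Φ i).sub_const M).ennreal_ofReal
  have hGflow : ∀ k : ℕ, Measurable fun z => G (Φ.flow ((k : ℝ) * window τ₁ N) z) := fun k =>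
    hGm.comp (Φ.measurable_flow _)
  -- pointwise Jensen along the window concatenation, on the good set
  have hpt : ∀ z ∈ Φ.good, ENNReal.ofReal (runAct σ (K * τ₁) Φ (window (K * τ₁) N) i z - M) ≤
      ENNReal.ofReal ((K : ℝ)⁻¹) * ∑ k ∈ Finset.range K, G (Φ.flow ((k : ℝ) * window τ₁ N) z) := by
    intro z hz
    rw [runAct_natMul_eq_avg Φ hz hτ₁ i K]
    refine (ofReal_avg_sub_le hK0
      (fun k => runAct σ τ₁ Φ (window τ₁ N) i (Φ.flow ((k : ℝ) * window τ₁ N) z)) M).trans (le_of_eq ?_)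
    congr 1
    refine Finset.sum_congr rfl fun k _ => ?_
    have hkz : Φ.flow ((k : ℝ) * window τ₁ N) z ∈ Φ.good := Φ.mapsTo_good _ hz
    simp only [hG, Set.indicator_of_mem hkz]
  calc ∫⁻ z, ENNReal.ofReal (runAct σ (K * τ₁) Φ (window (K * τ₁) N) i z - M) ∂(gibbs σ a₀ θ₀ u₀ N Φ)
      ≤ ∫⁻ z, ENNReal.ofReal ((K : ℝ)⁻¹) * ∑ k ∈ Finset.range K, G (Φ.flow ((k : ℝ) * window τ₁ N) z)
          ∂(gibbs σ a₀ θ₀ u₀ N Φ) :=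
        lintegral_mono_ae (by filter_upwards [hae] with z hz using hpt z hz)
    _ = ENNReal.ofReal ((K : ℝ)⁻¹) *
          ∑ k ∈ Finset.range K, ∫⁻ z, G (Φ.flow ((k : ℝ) * window τ₁ N) z) ∂(gibbs σ a₀ θ₀ u₀ N Φ) := by
        rw [lintegral_const_mul _ (Finset.measurable_sum _ fun k _ => hGflow k),
          lintegral_finsetSum _ fun k _ => hGflow k]
    _ = ENNReal.ofReal ((K : ℝ)⁻¹) * ∑ _k ∈ Finset.range K, ∫⁻ z, G z ∂(gibbs σ a₀ θ₀ u₀ N Φ) := by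
        congr 1
        exact Finset.sum_congr rfl fun k _ =>
          lintegral_comp_flow_localGibbsLaw_const σ a₀ θ₀ u₀ N Φ ((k : ℝ) * window τ₁ N) hGm
    _ = ∫⁻ z, G z ∂(gibbs σ a₀ θ₀ u₀ N Φ) := by
        rw [Finset.sum_const, Finset.card_range, nsmul_eq_mul, ← mul_assoc, ← ENNReal.ofReal_natCast K,
          ← ENNReal.ofReal_mul (inv_nonneg.2 (Nat.cast_nonneg K)), inv_mul_cancel₀ hKr, ENNReal.ofReal_one,
          one_mul]
    _ = ∫⁻ z, ENNReal.ofReal (runAct σ τ₁ Φ (window τ₁ N) i z - M) ∂(gibbs σ a₀ θ₀ u₀ N Φ) :=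
        lintegral_congr_ae (by
          filter_upwards [hae] with z hz
          simp only [hG, Set.indicator_of_mem hz])

end SketchLine

end Summit.AtomisticToContinuum.HydrodynamicLimit.Theorems.ClampedTransferCoin

end
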